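import Mathlib
import Literature.Analysis.FluidPDE.VectorCalculus
import Literature.Analysis.FluidPDE.TsaiHeadPressure
import Literature.Analysis.FluidPDE.TsaiMaximumPrinciple

/-!
# Sketch — crux-ideate stmt-NavierStokesRegularity-1217 (NoTypeIBlowup), ideator 3, round 1

First-lemma signatures of the two idea cards (they must elaborate; they are NOT proved here):

* `EternalConjugateDensityExists` — card `conjugate-current-pressure-drop`, first lemma (K1).
* `ParabolicHeadIdentity` — card `conjugate-current-pressure-drop`, the pointwise head identity it
  leans on (Pineau–Vicol (7.7) bookkeeping; verified symbolically, kit j005430 C4).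
* `TwistedHeadIdentity` — card `killing-twisted-bernoulli-solitons`, first lemma (the new identity
  `L_α Π_α = −|Ω|² + 2αΩ₃`; verified symbolically, kit j005430 C3).
* `SolitonEnstrophyLaw` — card `killing-twisted-bernoulli-solitons`, K2 (conjugate enstrophy of a
  Type-I rotated self-similar profile is at most `4α²`).
-/

open scoped Laplacian RealInnerProductSpace
open MeasureTheory Real

namespace Summit.NavierStokesRegularity.NavierStokesRegularity.Cruxes.Target.Sketch

local notation "ℝ³" => EuclideanSpace ℝ (Fin 3)

open Literature.Analysis.FluidPDE

/-- The similarity drift `b(s,y) = U(s,y) + y/2` of Leray's backward variables (rate `a = 1/2`). -/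
noncomputable def simDrift (U : ℝ → ℝ³ → ℝ³) (s : ℝ) (y : ℝ³) : ℝ³ := U s y + (2:ℝ)⁻¹ • y

/-- K1 of card `conjugate-current-pressure-drop`: ETERNAL CONJUGATE DENSITY. For every smooth
divergence-free coefficient field `U` on `ℝ × ℝ³` with the centred Type-I profile bounds
`|U| ≤ C/(1+|y|)`, `|∇U| ≤ C`, there is a positive, normalised, eternal (all `s ∈ ℝ`) classical
solution `m` of the backward adjoint (conjugate) equation `∂ₛ m = −Δm − ∇·((U + y/2) m)` with
two-sided Gaussian bounds whose constants depend only on `(C, ε)` (parabolic, two-sided-in-`s`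
extension of Pineau–Vicol arXiv:2607.09619 Prop. 5.1). -/
def EternalConjugateDensityExists : Prop :=
  ∀ (U : ℝ → ℝ³ → ℝ³) (C ε : ℝ), 0 < C → 0 < ε → ε < 1 →
    ContDiff ℝ 2 (Function.uncurry U) →
    (∀ s, VectorCalculus.IsDivFree (U s)) →
    (∀ s y, ‖U s y‖ ≤ C / (1 + ‖y‖)) →
    (∀ s y, ‖fderiv ℝ (U s) y‖ ≤ C) →
    ∃ (m : ℝ → ℝ³ → ℝ) (c M : ℝ), 0 < c ∧ 0 < M ∧
      ContDiff ℝ 2 (Function.uncurry m) ∧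
      (∀ s, ∫ y, m s y = 1) ∧
      (∀ s y, c * Real.exp (-(1 + ε) * ‖y‖ ^ 2 / 4) ≤ m s y ∧
              m s y ≤ M * Real.exp (-(1 - ε) * ‖y‖ ^ 2 / 4)) ∧
      (∀ s y, deriv (fun σ => m σ y) s =
          -(Δ (m s)) y - VectorCalculus.divergence (fun z => m s z • simDrift U s z) y)

/-- The pointwise parabolic head identity the card leans on: along a smooth solution of the
time-dependent Leray profile system `∂ₛU + U/2 + (y·∇)U/2 − ΔU + (U·∇)U + ∇P = 0`, `div U = 0`,
the head `Π = P + |U|²/2 + y·U/2` (`headPressure (1/2)`) satisfies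
`(∂ₛ − Δ + (U + y/2)·∇) Π = −|curl U|² + ∂ₛP` (kit j005430, identity C4). -/
def ParabolicHeadIdentity : Prop :=
  ∀ (U : ℝ → ℝ³ → ℝ³) (P : ℝ → ℝ³ → ℝ),
    ContDiff ℝ 3 (Function.uncurry U) → ContDiff ℝ 2 (Function.uncurry P) →
    (∀ s, VectorCalculus.IsDivFree (U s)) →
    (∀ s y, deriv (fun σ => U σ y) s + (2:ℝ)⁻¹ • U s y + (2:ℝ)⁻¹ • fderiv ℝ (U s) y y
        - (Δ (U s)) y + fderiv ℝ (U s) y (U s y) + gradient (P s) y = 0) →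
    ∀ s y, deriv (fun σ => headPressure 2⁻¹ (U σ) (P σ) y) s
        - (Δ (headPressure 2⁻¹ (U s) (P s))) y
        + fderiv ℝ (headPressure 2⁻¹ (U s) (P s)) y (simDrift U s y)
      = -‖curl (U s) y‖ ^ 2 + deriv (fun σ => P σ y) s

/-- The rotation generator about the `e₃`-axis, `J v = e₃ × v = (−v₂, v₁, 0)` (Pineau–Vicol (1.6)). -/
noncomputable def rotJ (v : ℝ³) : ℝ³ := cross (EuclideanSpace.single 2 1) v

/-- The Killing-twisted head of a rotated self-similar (RSS) profile with angular speed `α`: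
`Π_α = P + |U|²/2 + y·U/2 − α (Jy)·U`. -/
noncomputable def twistedHead (α : ℝ) (U : ℝ³ → ℝ³) (P : ℝ³ → ℝ) (y : ℝ³) : ℝ :=
  headPressure 2⁻¹ U P y - α * ⟪rotJ y, U y⟫

/-- First lemma of card `killing-twisted-bernoulli-solitons` (NEW identity, kit j005430 C3): for a
smooth solution of the RSS profile system of Pineau–Vicol (1.8),
`α(JU − (Jy·∇)U) + U/2 + (y·∇)U/2 − ΔU + (U·∇)U + ∇P = 0`, `div U = 0`, the twisted head satisfies
`L_α Π_α = −|curl U|² + 2α (curl U)₃` with `L_α = −Δ + (U + y/2 − αJy)·∇`. -/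
def TwistedHeadIdentity : Prop :=
  ∀ (α : ℝ) (U : ℝ³ → ℝ³) (P : ℝ³ → ℝ), ContDiff ℝ 3 U → ContDiff ℝ 2 P →
    VectorCalculus.IsDivFree U →
    (∀ y, α • (rotJ (U y) - fderiv ℝ U y (rotJ y)) + (2:ℝ)⁻¹ • U y + (2:ℝ)⁻¹ • fderiv ℝ U y y
          - (Δ U) y + fderiv ℝ U y (U y) + gradient P y = 0) →
    ∀ y, -(Δ (twistedHead α U P)) y
          + fderiv ℝ (twistedHead α U P) y (U y + (2:ℝ)⁻¹ • y - α • rotJ y)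
        = -‖curl U y‖ ^ 2 + 2 * α * (curl U y) 2

/-- K2 of card `killing-twisted-bernoulli-solitons`: SOLITON ENSTROPHY LAW. For a `C³` RSS profile
with the Type-I decay `|U| ≤ C/(1+|y|)` and any positive normalised kernel element `m` of the
rotating adjoint operator (`−Δm − ∇·((U + y/2 − αJy) m) = 0`) with Gaussian tails, the conjugate
enstrophy obeys `∫ |curl U|² m ≤ 4α²` (from `TwistedHeadIdentity` + `∫ (L_α f) m = 0` +
Cauchy–Schwarz). -/
def SolitonEnstrophyLaw : Prop :=
  ∀ (α C : ℝ) (U : ℝ³ → ℝ³) (P : ℝ³ → ℝ) (m : ℝ³ → ℝ), ContDiff ℝ 3 U → ContDiff ℝ 2 P →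
    ContDiff ℝ 2 m → VectorCalculus.IsDivFree U →
    (∀ y, ‖U y‖ ≤ C / (1 + ‖y‖)) → (∀ y, ‖fderiv ℝ U y‖ ≤ C / (1 + ‖y‖) ^ 2) →
    (∀ y, |P y| ≤ C / (1 + ‖y‖)) →
    (∀ y, α • (rotJ (U y) - fderiv ℝ U y (rotJ y)) + (2:ℝ)⁻¹ • U y + (2:ℝ)⁻¹ • fderiv ℝ U y y
          - (Δ U) y + fderiv ℝ U y (U y) + gradient P y = 0) →
    (∀ y, 0 < m y) → (∫ y, m y = 1) →
    (∃ M : ℝ, ∀ y, m y ≤ M * Real.exp (-‖y‖ ^ 2 / 8)) →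
    (∀ y, -(Δ m) y - VectorCalculus.divergence (fun z => m z • (U z + (2:ℝ)⁻¹ • z - α • rotJ z)) y = 0) →
    ∫ y, ‖curl U y‖ ^ 2 * m y ≤ 4 * α ^ 2

end Summit.NavierStokesRegularity.NavierStokesRegularity.Cruxes.Target.Sketch
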